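import Mathlib
import HarnessLib

/-!
# Crux `BirComplexStableXYR`, line `fat-gaussian-defect-calculus`: stub T2 `stub_feshbachFixedPoint`

Registered stub (lead c8, wave 12, chapter T-end, skeleton
`Cruxes/BirComplexStableXYR/Lines/fat_gaussian_defect_calculus.lean`), helper (`--supports`) for the crux
`Summit.HubbardSuperconductivity.HubbardSuperconductivity.Theses.BalabanIR.BirComplexStableXYR`:
**the Feshbach (Schur-complement) scalar fixed point.**  Generic functional analysis over a complex Banach
space `E`; no project definition is used.

**Statement.** In the normed ring `E →L[ℂ] E` of bounded operators let `M` be the complement block with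
`‖M‖ ≤ θ < 1`, let `b : E →L[ℂ] ℂ` (row functional), `c : E` (column) and `a : ℂ` satisfy
`‖b‖, ‖c‖, |a − 1| ≤ ε` with `0 ≤ ε`, `4ε ≤ 1 − θ`, and assume the resolvent bound (stub T1, taken as a
hypothesis): for `θ < |μ|` the operator `μ − M` is a unit and `‖(μ − M)⁻¹‖ ≤ 1/(|μ| − θ)`.  Then the dressed
eigenvalue equation `μ = a + b (μ − M)⁻¹ c` has exactly one solution with `|μ − 1| ≤ 2ε`.

**Proof.** Banach fixed point on the closed disc `D = {|μ − 1| ≤ 2ε}` (a complete metric space) for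
`G μ := a + b (R μ c)`, `R μ := (μ − M)⁻¹ = Ring.inverse (μ • 1 − M)`.  For `μ ∈ D` one has
`|μ| ≥ 1 − 2ε ≥ (1 + θ)/2 > θ`, so `R μ` exists and `‖R μ‖ ≤ 2/(1 − θ)`; hence
`|G μ − a| ≤ ‖b‖ ‖R μ‖ ‖c‖ ≤ ε · (2ε/(1 − θ)) ≤ ε/2` and `G` maps `D` into itself.  The resolvent identity
`R μ − R ν = (ν − μ) • (R μ * R ν)` (`hsc_fesh_resolvent_sub`, from `x⁻¹ − y⁻¹ = x⁻¹ (y − x) y⁻¹`,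
`hsc_fesh_inverse_sub`) gives `|G μ − G ν| ≤ ‖b‖ ‖c‖ ‖R μ‖ ‖R ν‖ |μ − ν| ≤ (2ε/(1 − θ))² |μ − ν| ≤ |μ − ν|/4`,
so `G` is a `1/4`-contraction of `D`: existence by `ContractingWith.fixedPoint` on the subtype `D`, uniqueness
directly from the contraction estimate.  Elementary given Mathlib; sorry-free. [folklore]
-/

set_option linter.dupNamespace false -- `Summit.<S>.<S>.Theorems…` repeats the summit name (D-0017 layout)

namespace Summit.HubbardSuperconductivity.HubbardSuperconductivity.Theorems.TEnd

open scoped ComplexConjugate NNReal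

/-- **Difference of inverses of two units** in a ring: `x⁻¹ − y⁻¹ = x⁻¹ (y − x) y⁻¹` (with `Ring.inverse`).
[folklore] -/
theorem hsc_fesh_inverse_sub {A : Type*} [Ring A] {x y : A} (hx : IsUnit x) (hy : IsUnit y) :
    Ring.inverse x - Ring.inverse y = Ring.inverse x * (y - x) * Ring.inverse y := by
  rw [mul_sub, sub_mul, mul_assoc, Ring.mul_inverse_cancel _ hy, mul_one, Ring.inverse_mul_cancel _ hx,
    one_mul]

/-- **Resolvent identity** in the algebra of bounded operators: if `μ − M` and `ν − M` are units then
`(μ − M)⁻¹ − (ν − M)⁻¹ = (ν − μ) • ((μ − M)⁻¹ (ν − M)⁻¹)` (with `Ring.inverse`). [folklore] -/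
theorem hsc_fesh_resolvent_sub {E : Type*} [NormedAddCommGroup E] [NormedSpace ℂ E]
    (M : E →L[ℂ] E) {μ ν : ℂ} (hμ : IsUnit (μ • (1 : E →L[ℂ] E) - M))
    (hν : IsUnit (ν • (1 : E →L[ℂ] E) - M)) :
    Ring.inverse (μ • (1 : E →L[ℂ] E) - M) - Ring.inverse (ν • (1 : E →L[ℂ] E) - M) =
      (ν - μ) • (Ring.inverse (μ • (1 : E →L[ℂ] E) - M) * Ring.inverse (ν • (1 : E →L[ℂ] E) - M)) := by
  have hBA : (ν • (1 : E →L[ℂ] E) - M) - (μ • (1 : E →L[ℂ] E) - M) = (ν - μ) • (1 : E →L[ℂ] E) := by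
    rw [sub_smul]; abel
  rw [hsc_fesh_inverse_sub hμ hν, hBA, mul_smul_comm, mul_one, smul_mul_assoc]

/-- **stub T2 (M, generic): the Feshbach (Schur-complement) fixed point.**  For block data `a ∈ ℂ`, row functional `b`,
column `c`, complement block `M` with `‖M‖ ≤ θ < 1`, `|a − 1|, ‖b‖, ‖c‖ ≤ ε`, `4ε ≤ 1 − θ`, and the resolvent bound (T1,
as a hypothesis), the dressed eigenvalue equation `μ = a + b (μ − M)⁻¹ c` has exactly one solution with `|μ − 1| ≤ 2ε`
(Banach fixed point on the closed disc: the map sends it into `|μ − a| ≤ ε/2` and is a `1/4`-contraction by the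
resolvent identity). [folklore] -/
theorem stub_feshbachFixedPoint :
    ∀ (E : Type) [NormedAddCommGroup E] [NormedSpace ℂ E] [CompleteSpace E]
      (M : E →L[ℂ] E) (b : E →L[ℂ] ℂ) (c : E) (a : ℂ) (θ ε : ℝ), 0 ≤ θ → θ < 1 → 0 ≤ ε → 4 * ε ≤ 1 - θ →
      ‖M‖ ≤ θ → ‖b‖ ≤ ε → ‖c‖ ≤ ε → ‖a - 1‖ ≤ ε →
      (∀ μ : ℂ, θ < ‖μ‖ → IsUnit (μ • (1 : E →L[ℂ] E) - M) ∧
          ‖Ring.inverse (μ • (1 : E →L[ℂ] E) - M)‖ ≤ 1 / (‖μ‖ - θ)) →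
      ∃! μ : ℂ, ‖μ - 1‖ ≤ 2 * ε ∧ μ = a + b (Ring.inverse (μ • (1 : E →L[ℂ] E) - M) c) := by
  intro E _ _ _ M b c a θ ε _hθ0 hθ1 hε0 hε _hM hb hc ha hR
  -- notation: the resolvent `R` and the Feshbach map `G`
  set R : ℂ → (E →L[ℂ] E) := fun μ => Ring.inverse (μ • (1 : E →L[ℂ] E) - M) with hRdef
  set G : ℂ → ℂ := fun μ => a + b (R μ c) with hGdef
  have h1θ : 0 < 1 - θ := by linarith
  -- the constant `K = 2/(1-θ)` bounding the resolvent on the disc, with `K ε ≤ 1/2`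
  set K : ℝ := 2 / (1 - θ) with hKdef
  have hK0 : 0 ≤ K := (div_pos two_pos h1θ).le
  have hKε : K * ε ≤ 1 / 2 := by
    rw [hKdef, div_mul_eq_mul_div, div_le_div_iff₀ h1θ two_pos]
    linarith
  -- on the disc: `θ < |μ|`, hence the resolvent exists and `‖R μ‖ ≤ K`
  have hball : ∀ μ : ℂ, ‖μ - 1‖ ≤ 2 * ε → θ < ‖μ‖ ∧ ‖R μ‖ ≤ K := by
    intro μ hμ
    have hnorm : 1 - 2 * ε ≤ ‖μ‖ := by
      have h := norm_sub_norm_le (1 : ℂ) μ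
      rw [norm_one, norm_sub_rev] at h
      linarith
    have hθμ : θ < ‖μ‖ := by linarith
    refine ⟨hθμ, ?_⟩
    calc ‖R μ‖ ≤ 1 / (‖μ‖ - θ) := (hR μ hθμ).2
      _ ≤ K := by
        rw [hKdef, div_le_div_iff₀ (by linarith) h1θ]
        linarith
  -- `G` maps the disc into the smaller disc `|G μ − a| ≤ ε/2`
  have hGa : ∀ μ : ℂ, ‖μ - 1‖ ≤ 2 * ε → ‖G μ - a‖ ≤ ε / 2 := by
    intro μ hμ
    obtain ⟨-, hRμ⟩ := hball μ hμ
    have hGμ : G μ - a = b (R μ c) := by simp [hGdef]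
    have hRc : ‖R μ c‖ ≤ K * ε :=
      ((R μ).le_opNorm c).trans (mul_le_mul hRμ hc (norm_nonneg _) hK0)
    rw [hGμ]
    calc ‖b (R μ c)‖ ≤ ‖b‖ * ‖R μ c‖ := b.le_opNorm _
      _ ≤ ε * (K * ε) := mul_le_mul hb hRc (norm_nonneg _) hε0
      _ ≤ ε * (1 / 2) := mul_le_mul_of_nonneg_left hKε hε0
      _ = ε / 2 := by ring
  have hmaps : ∀ μ : ℂ, ‖μ - 1‖ ≤ 2 * ε → ‖G μ - 1‖ ≤ 2 * ε := by
    intro μ hμ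
    calc ‖G μ - 1‖ = ‖(G μ - a) + (a - 1)‖ := by rw [sub_add_sub_cancel]
      _ ≤ ‖G μ - a‖ + ‖a - 1‖ := norm_add_le _ _
      _ ≤ ε / 2 + ε := add_le_add (hGa μ hμ) ha
      _ ≤ 2 * ε := by linarith
  -- `G` is a `1/4`-contraction on the disc (resolvent identity)
  have hlip : ∀ μ ν : ℂ, ‖μ - 1‖ ≤ 2 * ε → ‖ν - 1‖ ≤ 2 * ε → ‖G μ - G ν‖ ≤ 1 / 4 * ‖μ - ν‖ := by
    intro μ ν hμ hν
    obtain ⟨hθμ, hRμ⟩ := hball μ hμ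
    obtain ⟨hθν, hRν⟩ := hball ν hν
    have hres : R μ - R ν = (ν - μ) • (R μ * R ν) :=
      hsc_fesh_resolvent_sub M (hR μ hθμ).1 (hR ν hθν).1
    have hGG : G μ - G ν = b ((R μ - R ν) c) := by
      rw [sub_apply, map_sub]
      simp only [hGdef]
      ring
    rw [hGG, hres]
    calc ‖b (((ν - μ) • (R μ * R ν)) c)‖ ≤ ‖b‖ * ‖((ν - μ) • (R μ * R ν)) c‖ := b.le_opNorm _
      _ ≤ ‖b‖ * (‖(ν - μ) • (R μ * R ν)‖ * ‖c‖) :=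
          mul_le_mul_of_nonneg_left (ContinuousLinearMap.le_opNorm _ _) (norm_nonneg _)
      _ ≤ ‖b‖ * ((‖ν - μ‖ * (‖R μ‖ * ‖R ν‖)) * ‖c‖) := by
          gcongr
          rw [norm_smul]
          gcongr
          exact norm_mul_le _ _
      _ ≤ ε * ((‖ν - μ‖ * (K * K)) * ε) := by gcongr
      _ = (K * ε) ^ 2 * ‖μ - ν‖ := by rw [norm_sub_rev]; ring
      _ ≤ (1 / 2) ^ 2 * ‖μ - ν‖ := by gcongr
      _ = 1 / 4 * ‖μ - ν‖ := by norm_num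
  -- Banach fixed point on the complete metric space `D`
  set D : Set ℂ := Metric.closedBall (1 : ℂ) (2 * ε) with hDdef
  have hDmem : ∀ μ : ℂ, μ ∈ D ↔ ‖μ - 1‖ ≤ 2 * ε := fun μ => by
    rw [hDdef, Metric.mem_closedBall, dist_eq_norm]
  haveI : CompleteSpace D := (Metric.isClosed_closedBall.isComplete).completeSpace_coe
  haveI : Nonempty D := ⟨⟨1, (hDmem 1).2 (by simpa using hε0)⟩⟩
  let g : D → D := fun x => ⟨G x, (hDmem _).2 (hmaps x (by exact (hDmem _).1 x.2))⟩
  have hg : ContractingWith (1 / 4 : ℝ≥0) g := by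
    refine ⟨by norm_num, LipschitzWith.of_dist_le_mul fun x y => ?_⟩
    rw [Subtype.dist_eq, Subtype.dist_eq, dist_eq_norm, dist_eq_norm]
    push_cast
    exact hlip x y ((hDmem _).1 x.2) ((hDmem _).1 y.2)
  obtain ⟨x, hx⟩ : ∃ x : D, g x = x := ⟨ContractingWith.fixedPoint g hg, hg.fixedPoint_isFixedPt⟩
  have hxfix : G x = x := congrArg Subtype.val hx
  refine ⟨(x : ℂ), ⟨(hDmem _).1 x.2, hxfix.symm⟩, ?_⟩
  -- uniqueness from the contraction estimate
  rintro y ⟨hyD, hyfix⟩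
  have hy : G y = y := hyfix.symm
  have hle : ‖y - x‖ ≤ 1 / 4 * ‖y - x‖ := by
    have := hlip y x hyD ((hDmem _).1 x.2)
    rwa [hy, hxfix] at this
  have h0 : ‖y - (x : ℂ)‖ = 0 := by linarith [norm_nonneg (y - (x : ℂ))]
  exact sub_eq_zero.mp (norm_eq_zero.mp h0)

end Summit.HubbardSuperconductivity.HubbardSuperconductivity.Theorems.TEnd
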